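import Summits.AtomisticToContinuum.HydrodynamicLimit.Theorems.RelayRaceLocalityNearConstantShortTimeHLSmallTiltGronwallDefs
import Summits.AtomisticToContinuum.HydrodynamicLimit.Theorems.SuperextensiveClosureCostBlockEntropyBudgetBallAverages
import Literature.MathematicalPhysics.KineticTheory.HardSphereEulerProofs
import HarnessLib

/-!
# Crux `NearConstantShortTimeHL` (stmt-AtomisticToContinuum-12502), line `small-tilt-domination` — commutators

Support file for the crux `…Theses.RelayRaceLocality.NearConstantShortTimeHL`, line `small-tilt-domination`
(lead c3, wave 1): the six registered commutator stubs `integrable_mul_ballDensity`,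
`integrable_mul_ballMomentum_apply`, `integrable_mul_ballEnergy`, `abs_empiricalDensityField_sub_integral_ball_le`,
`abs_sum_empiricalMomentumField_sub_integral_ball_le`, `abs_empiricalEnergyField_sub_integral_ball_le`.

The Gronwall assembly tests the RAW empirical fields `ρ_w[f]`, `m_w[g]`, `e_w[f]` against the smooth log-profile rows,
whereas the closure stubs speak about the BALL-AVERAGED fields `ρ̃_w(x) = ρ_w[ballKernel ℓ x]`, `m̃_w`, `ẽ_w`. The
lemmas of this file are the commutators between the two: since `∫ ballKernel ℓ x y dx = 1` (`0 < ℓ < 1/2`),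
`ρ_w[f] − ∫ f ρ̃_w = n⁻¹ ∑ᵢ ∫ (f(xᵢ) − f(x)) ballKernel ℓ x xᵢ dx`, and the kernel vanishes unless `d(x, xᵢ) < ℓ`,
where `|f(xᵢ) − f(x)| ≤ ω` (`ω` = modulus of continuity of the test at scale `ℓ`). The prices are the conserved
totals `1`, `n⁻¹ ∑ᵢ ‖vᵢ‖`, `n⁻¹ ∑ᵢ ‖vᵢ‖² / 2`.

References: H. Spohn, *Large Scale Dynamics of Interacting Particles* (1991), Part I §3.1; C. Kipnis – C. Landim,
*Scaling Limits of Interacting Particle Systems* (1999), App. 1 §8 (elementary; folklore).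
-/

noncomputable section

namespace Summit.AtomisticToContinuum.HydrodynamicLimit.Theorems.NearConstantShortTimeHL

open scoped BigOperators ENNReal
open MeasureTheory Set Filter
open Literature.MathematicalPhysics.KineticTheory Literature.Analysis.FluidPDE Literature.Analysis.FunctionSpaces

/-! ## Integrability of continuous functions against the ball kernel -/

/-- The product of a continuous function with the ball kernel `x ↦ ballKernel ℓ x y` (any radius `ℓ`, any centre
`y`) is integrable: a continuous function on the compact torus is bounded, hence integrable for the Haar probability
measure, and the product is the indicator of a measurable ball applied to an integrable function. [folklore] -/
theorem integrable_continuous_mul_ballKernel (ℓ : ℝ) {f : T3 → ℝ} (hf : Continuous f) (y : T3) :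
    Integrable (fun x => f x * ballKernel ℓ x y) := by
  obtain ⟨C, hC⟩ := isCompact_univ.exists_bound_of_continuousOn hf.continuousOn
  have hfi : Integrable f :=
    Integrable.of_bound hf.aestronglyMeasurable C (ae_of_all _ fun x => hC x (mem_univ x))
  have h : (fun x => f x * ballKernel ℓ x y) =
      {x : T3 | Torus.euclidDist x y < ℓ}.indicator (fun x => f x * (4 / 3 * Real.pi * ℓ ^ 3)⁻¹) := by
    funext x
    simp only [ballKernel, Set.indicator_apply, Set.mem_setOf_eq, mul_ite, mul_zero]
  rw [h]
  exact (hfi.mul_const _).indicator (measurableSet_setOf_euclidDist_lt ℓ y)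

/-- Coordinates of the empirical momentum field: `(m_w[χ])ⱼ = n⁻¹ ∑ᵢ χ(xᵢ) vᵢⱼ`. [folklore] -/
theorem empiricalMomentumField_apply_eq_sum {n : ℕ} (w : Config n (Fin 3) T3) (χ : T3 → ℝ) (j : Fin 3) :
    empiricalMomentumField w χ j = (n : ℝ)⁻¹ * ∑ i, χ (w i).1 * (w i).2 j := by
  rw [empiricalMomentumField_eq_sum]
  simp only [PiLp.smul_apply, WithLp.ofLp_sum, Finset.sum_apply, smul_eq_mul, WithLp.ofLp_smul, Pi.smul_apply]

/-- The Euclidean inner product of `ℝ³` in coordinates: `⟪a, b⟫ = ∑ⱼ aⱼ bⱼ`. [folklore] -/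
theorem inner_eq_sum_mul_V3 (a b : V3) : inner ℝ a b = ∑ j, a j * b j := by
  simp [PiLp.inner_apply, mul_comm]

/-- **Registered stub `integrable_mul_ballDensity`.** `x ↦ f(x) ρ̃_w(x)` is integrable on `𝕋³` for continuous `f`
(any radius). [folklore] -/
theorem integrable_mul_ballDensity : ∀ {n : ℕ} (ℓ : ℝ) {f : T3 → ℝ}, Continuous f → ∀ w : Config n (Fin 3) T3, Integrable (fun x => f x * empiricalDensityField w (ballKernel ℓ x)) := by
  intro n ℓ f hf w
  have h : (fun x => f x * empiricalDensityField w (ballKernel ℓ x)) =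
      fun x => (n : ℝ)⁻¹ * ∑ i, f x * ballKernel ℓ x (w i).1 := by
    funext x
    rw [empiricalDensityField_eq_sum, ← Finset.mul_sum]
    ring
  rw [h]
  exact (integrable_finsetSum _ fun i _ => integrable_continuous_mul_ballKernel ℓ hf (w i).1).const_mul _

/-- **Registered stub `integrable_mul_ballMomentum_apply`.** `x ↦ f(x) m̃_w(x)ⱼ` is integrable on `𝕋³` for
continuous `f` (any radius, every coordinate `j`). [folklore] -/
theorem integrable_mul_ballMomentum_apply : ∀ {n : ℕ} (ℓ : ℝ) {f : T3 → ℝ}, Continuous f → ∀ (w : Config n (Fin 3) T3) (j : Fin 3), Integrable (fun x => f x * (empiricalMomentumField w (ballKernel ℓ x)) j) := by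
  intro n ℓ f hf w j
  have h : (fun x => f x * (empiricalMomentumField w (ballKernel ℓ x)) j) =
      fun x => (n : ℝ)⁻¹ * ∑ i, f x * (w i).2 j * ballKernel ℓ x (w i).1 := by
    funext x
    rw [empiricalMomentumField_apply_eq_sum]
    simp only [Finset.mul_sum]
    exact Finset.sum_congr rfl fun i _ => by ring
  rw [h]
  exact (integrable_finsetSum _ fun i _ =>
    integrable_continuous_mul_ballKernel ℓ (hf.mul continuous_const) (w i).1).const_mul _

/-- **Registered stub `integrable_mul_ballEnergy`.** `x ↦ f(x) ẽ_w(x)` is integrable on `𝕋³` for continuous `f`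
(any radius). [folklore] -/
theorem integrable_mul_ballEnergy : ∀ {n : ℕ} (ℓ : ℝ) {f : T3 → ℝ}, Continuous f → ∀ w : Config n (Fin 3) T3, Integrable (fun x => f x * empiricalEnergyField w (ballKernel ℓ x)) := by
  intro n ℓ f hf w
  have h : (fun x => f x * empiricalEnergyField w (ballKernel ℓ x)) =
      fun x => (n : ℝ)⁻¹ * ∑ i, f x * (‖(w i).2‖ ^ 2 / 2) * ballKernel ℓ x (w i).1 := by
    funext x
    rw [empiricalEnergyField_eq_sum]
    simp only [Finset.mul_sum]
    exact Finset.sum_congr rfl fun i _ => by ring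
  rw [h]
  exact (integrable_finsetSum _ fun i _ =>
    integrable_continuous_mul_ballKernel ℓ (hf.mul continuous_const) (w i).1).const_mul _

/-! ## The commutators -/

/-- **One-particle commutator.** For `0 < ℓ < 1/2`, a continuous `φ` and a centre `y` with `|φ y − φ x| ≤ ω'`
whenever `d(x, y) < ℓ`: `|φ(y) − ∫ φ(x) ballKernel ℓ x y dx| ≤ ω'` — because `∫ ballKernel ℓ x y dx = 1` and the
kernel is nonnegative and supported in the ball. [folklore] -/
theorem abs_sub_integral_mul_ballKernel_le {ℓ : ℝ} (hℓ0 : 0 < ℓ) (hℓ : ℓ < 1 / 2) {φ : T3 → ℝ}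
    (hφ : Continuous φ) (y : T3) {ω' : ℝ} (hω : ∀ x, Torus.euclidDist x y < ℓ → |φ y - φ x| ≤ ω') :
    |φ y - ∫ x, φ x * ballKernel ℓ x y| ≤ ω' := by
  have h1 : ∫ x, ballKernel ℓ x y = 1 := integral_ballKernel_eq_one hℓ0 hℓ y
  have hint : Integrable (fun x => φ x * ballKernel ℓ x y) := integrable_continuous_mul_ballKernel ℓ hφ y
  have hintc : ∀ c : ℝ, Integrable (fun x => c * ballKernel ℓ x y) := fun c =>
    integrable_continuous_mul_ballKernel ℓ continuous_const y
  have heq : ∫ x, (φ y - φ x) * ballKernel ℓ x y = φ y - ∫ x, φ x * ballKernel ℓ x y := by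
    simp_rw [sub_mul]
    rw [integral_sub (hintc _) hint, integral_const_mul, h1, mul_one]
  rw [← heq, ← Real.norm_eq_abs]
  calc ‖∫ x, (φ y - φ x) * ballKernel ℓ x y‖ ≤ ∫ x, ω' * ballKernel ℓ x y := by
        refine norm_integral_le_of_norm_le (hintc _) (ae_of_all _ fun x => ?_)
        rw [Real.norm_eq_abs, abs_mul, abs_of_nonneg (ballKernel_nonneg ℓ x y)]
        by_cases hxy : Torus.euclidDist x y < ℓ
        · exact mul_le_mul_of_nonneg_right (hω x hxy) (ballKernel_nonneg ℓ x y)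
        · have h0 : ballKernel ℓ x y = 0 := by simp [ballKernel, hxy]
          rw [h0, mul_zero, mul_zero]
    _ = ω' := by rw [integral_const_mul, h1, mul_one]

/-- **Averaged commutator.** For `0 < ℓ < 1/2`, continuous `φᵢ`, centres `yᵢ` and moduli `ω'ᵢ` with
`|φᵢ(yᵢ) − φᵢ(x)| ≤ ω'ᵢ` whenever `d(x, yᵢ) < ℓ`:
`|n⁻¹ ∑ᵢ φᵢ(yᵢ) − ∫ n⁻¹ ∑ᵢ φᵢ(x) ballKernel ℓ x yᵢ dx| ≤ n⁻¹ ∑ᵢ ω'ᵢ`. [folklore] -/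
theorem abs_avg_sub_integral_avg_mul_ballKernel_le {n : ℕ} {ℓ : ℝ} (hℓ0 : 0 < ℓ) (hℓ : ℓ < 1 / 2)
    (φ : Fin n → T3 → ℝ) (hφ : ∀ i, Continuous (φ i)) (y : Fin n → T3) (ω' : Fin n → ℝ)
    (hω : ∀ i x, Torus.euclidDist x (y i) < ℓ → |φ i (y i) - φ i x| ≤ ω' i) :
    |(n : ℝ)⁻¹ * ∑ i, φ i (y i) - ∫ x, (n : ℝ)⁻¹ * ∑ i, φ i x * ballKernel ℓ x (y i)| ≤
      (n : ℝ)⁻¹ * ∑ i, ω' i := by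
  rw [integral_const_mul, integral_finsetSum _ fun i _ => integrable_continuous_mul_ballKernel ℓ (hφ i) (y i),
    ← mul_sub, ← Finset.sum_sub_distrib, abs_mul, abs_of_nonneg (inv_nonneg.2 (Nat.cast_nonneg n))]
  refine mul_le_mul_of_nonneg_left ?_ (inv_nonneg.2 (Nat.cast_nonneg n))
  exact (Finset.abs_sum_le_sum_abs _ _).trans
    (Finset.sum_le_sum fun i _ => abs_sub_integral_mul_ballKernel_le hℓ0 hℓ (hφ i) (y i) (hω i))

/-- **Registered stub `abs_empiricalDensityField_sub_integral_ball_le`.** Density commutator: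
`|ρ_w[f] − ∫ f ρ̃_w| ≤ ω` for `n ≥ 1` particles, `0 < ℓ < 1/2` and `ω` a modulus of continuity of `f` at scale `ℓ`.
[folklore] -/
theorem abs_empiricalDensityField_sub_integral_ball_le : ∀ {n : ℕ}, n ≠ 0 → ∀ {ℓ : ℝ}, 0 < ℓ → ℓ < 1 / 2 → ∀ {f : T3 → ℝ}, Continuous f → ∀ {ω : ℝ}, (∀ x y : T3, Torus.euclidDist x y < ℓ → |f x - f y| ≤ ω) → ∀ w : Config n (Fin 3) T3, |empiricalDensityField w f - ∫ x, f x * empiricalDensityField w (ballKernel ℓ x)| ≤ ω := by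
  intro n hn ℓ hℓ0 hℓ f hf ω hω w
  have h : (fun x => f x * empiricalDensityField w (ballKernel ℓ x)) =
      fun x => (n : ℝ)⁻¹ * ∑ i, f x * ballKernel ℓ x (w i).1 := by
    funext x
    rw [empiricalDensityField_eq_sum, ← Finset.mul_sum]
    ring
  rw [h, empiricalDensityField_eq_sum]
  have key := abs_avg_sub_integral_avg_mul_ballKernel_le hℓ0 hℓ (fun _ => f) (fun _ => hf) (fun i => (w i).1)
    (fun _ => ω) (fun i x hx => by rw [abs_sub_comm]; exact hω x (w i).1 hx)
  refine key.trans_eq ?_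
  rw [Finset.sum_const, Finset.card_univ, Fintype.card_fin, nsmul_eq_mul, ← mul_assoc,
    inv_mul_cancel₀ (Nat.cast_ne_zero.2 hn), one_mul]

/-- **Registered stub `abs_sum_empiricalMomentumField_sub_integral_ball_le`.** Momentum commutator:
`|∑ⱼ m_w[gⱼ]ⱼ − ∫ ∑ⱼ gⱼ m̃_{w,j}| ≤ ω · n⁻¹ ∑ᵢ ‖vᵢ‖` for `0 < ℓ < 1/2` and `ω` a modulus of continuity of the
vector test `g` at scale `ℓ` (Cauchy–Schwarz in `ℝ³` particle by particle). [folklore] -/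
theorem abs_sum_empiricalMomentumField_sub_integral_ball_le : ∀ {n : ℕ} {ℓ : ℝ}, 0 < ℓ → ℓ < 1 / 2 → ∀ {g : T3 → V3}, Continuous g → ∀ {ω : ℝ}, (∀ x y : T3, Torus.euclidDist x y < ℓ → ‖g x - g y‖ ≤ ω) → ∀ w : Config n (Fin 3) T3, |(∑ j, (empiricalMomentumField w (fun y => g y j)) j) - ∫ x, (∑ j, g x j * (empiricalMomentumField w (ballKernel ℓ x)) j)| ≤ ω * ((n : ℝ)⁻¹ * ∑ i, ‖(w i).2‖) := by
  intro n ℓ hℓ0 hℓ g hg ω hω w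
  have h1 : (∑ j, (empiricalMomentumField w (fun y => g y j)) j) =
      (n : ℝ)⁻¹ * ∑ i, inner ℝ (g (w i).1) (w i).2 := by
    simp_rw [empiricalMomentumField_apply_eq_sum, inner_eq_sum_mul_V3]
    rw [← Finset.mul_sum, Finset.sum_comm]
  have h2 : (fun x => ∑ j, g x j * (empiricalMomentumField w (ballKernel ℓ x)) j) =
      fun x => (n : ℝ)⁻¹ * ∑ i, inner ℝ (g x) (w i).2 * ballKernel ℓ x (w i).1 := by
    funext x
    simp_rw [empiricalMomentumField_apply_eq_sum, inner_eq_sum_mul_V3]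
    simp only [Finset.mul_sum, Finset.sum_mul]
    rw [Finset.sum_comm]
    exact Finset.sum_congr rfl fun i _ => Finset.sum_congr rfl fun j _ => by ring
  rw [h1, h2]
  have key := abs_avg_sub_integral_avg_mul_ballKernel_le hℓ0 hℓ (fun i x => inner ℝ (g x) (w i).2)
    (fun i => hg.inner continuous_const) (fun i => (w i).1) (fun i => ω * ‖(w i).2‖)
    (fun i x hx => by
      rw [← inner_sub_left]
      refine (abs_real_inner_le_norm _ _).trans (mul_le_mul_of_nonneg_right ?_ (norm_nonneg _))
      rw [norm_sub_rev]
      exact hω x (w i).1 hx)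
  refine key.trans_eq ?_
  rw [← Finset.mul_sum]
  ring

/-- **Registered stub `abs_empiricalEnergyField_sub_integral_ball_le`.** Energy commutator:
`|e_w[f] − ∫ f ẽ_w| ≤ ω · n⁻¹ ∑ᵢ ‖vᵢ‖²/2` for `0 < ℓ < 1/2` and `ω` a modulus of continuity of `f` at scale `ℓ`.
[folklore] -/
theorem abs_empiricalEnergyField_sub_integral_ball_le : ∀ {n : ℕ} {ℓ : ℝ}, 0 < ℓ → ℓ < 1 / 2 → ∀ {f : T3 → ℝ}, Continuous f → ∀ {ω : ℝ}, (∀ x y : T3, Torus.euclidDist x y < ℓ → |f x - f y| ≤ ω) → ∀ w : Config n (Fin 3) T3, |empiricalEnergyField w f - ∫ x, f x * empiricalEnergyField w (ballKernel ℓ x)| ≤ ω * ((n : ℝ)⁻¹ * ∑ i, ‖(w i).2‖ ^ 2 / 2) := by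
  intro n ℓ hℓ0 hℓ f hf ω hω w
  have h : (fun x => f x * empiricalEnergyField w (ballKernel ℓ x)) =
      fun x => (n : ℝ)⁻¹ * ∑ i, f x * (‖(w i).2‖ ^ 2 / 2) * ballKernel ℓ x (w i).1 := by
    funext x
    rw [empiricalEnergyField_eq_sum]
    simp only [Finset.mul_sum]
    exact Finset.sum_congr rfl fun i _ => by ring
  rw [h, empiricalEnergyField_eq_sum]
  have key := abs_avg_sub_integral_avg_mul_ballKernel_le hℓ0 hℓ (fun i x => f x * (‖(w i).2‖ ^ 2 / 2))
    (fun i => hf.mul continuous_const) (fun i => (w i).1) (fun i => ω * (‖(w i).2‖ ^ 2 / 2))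
    (fun i x hx => by
      rw [← sub_mul, abs_mul, abs_of_nonneg (by positivity : (0 : ℝ) ≤ ‖(w i).2‖ ^ 2 / 2), abs_sub_comm]
      exact mul_le_mul_of_nonneg_right (hω x (w i).1 hx) (by positivity))
  refine key.trans_eq ?_
  rw [← Finset.mul_sum]
  ring

end Summit.AtomisticToContinuum.HydrodynamicLimit.Theorems.NearConstantShortTimeHL

end
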